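import Literature.Topology.FourManifolds.BranchedDoubleQuotient
import Literature.Geometry.Kaehler.RealStructure
import Mathlib.Geometry.Manifold.IsManifold.Basic
import Mathlib.Topology.Compactness.Compact
import HarnessLib

/-!
# The Arnold–Rokhlin smooth structure on the orbit space `X/conj` of a real surface (existence)

Topic `Topology/FourManifolds`; namespace `Literature.Topology.FourManifolds`. A NAMED FACT
(`def … : Prop`, no axioms, no `sorry`), vendored by the grounder of route
`SmoothPoincare4/RealQuotientSpheres`; it grounds the support item
`Summit.SmoothPoincare4.SmoothPoincare4.Theses.RealQuotientSpheres.RqQuotientExists`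
(ledger `stmt-SmoothPoincare4-7155`), which is this fact specialised to involutions with a
real point and with the tree predicates `IsRealStructure` / `IsBranchedDoubleQuotient` unfolded
coordinatewise (checked in the grounder's scratch file: `fact → RqQuotientExists` by
destructuring and `simp` on coordinates).

## The printed statement

For a nonsingular complex surface `X` with a real structure (an anti-holomorphic involution
`conj`, Finashin's "complex conjugation"), the orbit space `Y = X/conj` is a closed `4`-manifold
carrying a smooth structure for which the projection `q : X → Y` is a smooth double covering
branched along the real part `X_ℝ = Fix conj`:

* Degtyarev–Kharlamov, *Topological properties of real algebraic varieties: du côté de chez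
  Rokhlin*, Russian Math. Surveys 55:4 (2000) = arXiv:math/0004134, §3.2 (arXiv p. 14, lines
  22–26): "the fixed point set of the complex conjugation has codimension `2`. Hence, the
  quotient `X/conj` is a manifold; moreover, one can easily see that, up to isotopy, there is a
  unique smooth structure on `X/conj` such that the projection `X → X/conj` is a double covering
  branched over `ℝX`."
* Finashin, *Decomposability of quotients by complex conjugation for rational and Enriques
  surfaces*, Topology Appl. 79 (1997) = arXiv:dg-ga/9603004, §1.1 ¶1: "If `X` is nonsingular,
  then `Y` is a closed `4`-manifold, which inherits an orientation and smooth structure from `X`,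
  so that the quotient map, `q : X → Y`, is an orientation preserving and smooth double covering
  branched along the fixed points set, `X_ℝ`, of the conjugation."
* Finashin, *Rokhlin conjecture and quotients of complex surfaces by complex conjugation*,
  J. reine angew. Math. 481 (1996) = arXiv:dg-ga/9506007, §1 ¶2 (same sentence); Finashin,
  arXiv:math/9903112 (1999), §1.1: "One can endow `X̄` with an orientation and a smooth structure
  making `q` smooth and orientation preserving, for example `P̄² = ℂP²/conj` is well known to be
  diffeomorphic to `S⁴`" (Kuiper 1974, Massey 1973).

The construction (Arnold; Kuiper; Massey; Finashin 1996 §1): off `X_ℝ` the free involution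
gives an honest double cover; along the totally real surface `X_ℝ` one takes a `conj`-invariant
metric, the exponential tubular neighbourhood of `X_ℝ` with orthonormal normal frames, and the
squaring map `v ↦ v²` on the normal `ℂ ≅ ℝ²` (on which `conj` acts by `-1`), i.e. the local model
`(z, w) ↦ (Re z, Re w, (Im z)² − (Im w)², 2 Im z Im w)` of the tree's
`Literature.Topology.FourManifolds.branchedDoubleModel`; the transition maps, conformal-linear on
normal fibres, descend smoothly through the squaring map (equivariant tubular neighbourhood
theorem, Bredon 1972 VI.2).

## What is vendored (existence half only)

`conjQuotient_smoothStructure_exists`: for every compact Hausdorff second-countable complex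
surface `X` (`ChartedSpace (Fin 2 → ℂ) X`, `IsManifold 𝓘(ℂ, Fin 2 → ℂ) ω X`) and every real
structure `σ` on it (`Literature.Geometry.Kaehler.IsRealStructure 𝓘(ℂ, Fin 2 → ℂ) σ`: an
anti-holomorphic involution), there are a compact Hausdorff second-countable `C^∞` `4`-manifold
`Y` (`ChartedSpace (EuclideanSpace ℝ (Fin 4)) Y`, `IsManifold (𝓡 4) ∞ Y`) and `q : X → Y` with
`Literature.Topology.FourManifolds.IsBranchedDoubleQuotient σ q` (topological quotient by `σ`,
smooth, a local diffeomorphism off `Fix σ`, the standard branched model at real points).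
The printed statement has no hypothesis `X_ℝ ≠ ∅` (for a free `σ` the branching clause is
vacuous and `q` is a smooth double cover), so none is imposed; compactness of `X` is kept as in
the sources ("closed 4-manifold"). The UNIQUENESS half (up to isotopy/diffeomorphism) and
orientations are not vendored here.

## Search record (grounder, 2026-08-15)

Tree: `lean search 'branched|Branched'` — only `BranchedDoubleQuotient.lean` (the predicate; its
docstring defers existence to this item) and prose; Mathlib has no orbit-space manifold
structures. Literature: the statement is used as folklore in every source above and in
Matić–Öztürk–Reyes–Stipsicz–Urzúa, arXiv:2312.03617 (2024) §1; no source states more than the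
sentence quoted, hence a named fact rather than a proof.

## References

* [DegtyarevKharlamov2000] A. Degtyarev, V. Kharlamov, *Topological properties of real algebraic
  varieties: du côté de chez Rokhlin*, Uspekhi Mat. Nauk 55 (2000), no. 4, 129–212; Russian
  Math. Surveys 55 (2000), 735–814; arXiv:math/0004134, §3.2.
* [Finashin1997] S. Finashin, *Decomposability of quotients by complex conjugation for rational
  and Enriques surfaces*, Topology Appl. 79 (1997), 121–128; arXiv:dg-ga/9603004, §1.1.
* [Finashin1996] S. Finashin, *Rokhlin conjecture and quotients of complex surfaces by complex
  conjugation*, J. reine angew. Math. 481 (1996), 55–71; arXiv:dg-ga/9506007, §1.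
* [Kuiper1974] N. H. Kuiper, Math. Ann. 208 (1974), 175–177. [Massey1973] W. S. Massey, Geom.
  Dedicata 2 (1973), 371–374. [Bredon1972] G. E. Bredon, *Introduction to compact
  transformation groups* (1972), VI.2.
-/

noncomputable section

open scoped Manifold ContDiff

namespace Literature.Topology.FourManifolds

/-- **Arnold–Rokhlin smoothing of `X/conj` (existence).** For a compact complex surface `X`
(Hausdorff, second countable, charts in `ℂ²` with holomorphic — `C^ω` over `ℂ` — transition
maps) and a real structure `σ` on `X` (an anti-holomorphic involution,
`IsRealStructure 𝓘(ℂ, Fin 2 → ℂ) σ`), the orbit space carries the structure of a closed smooth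
`4`-manifold making the projection a smooth double covering branched along `Fix σ` with the
standard local model: there exist a compact Hausdorff second-countable `C^∞` manifold `Y`
modelled on `𝓡 4` and `q : X → Y` with `IsBranchedDoubleQuotient σ q`.
Degtyarev–Kharlamov 2000, §3.2: "the quotient `X/conj` is a manifold; moreover, one can easily
see that, up to isotopy, there is a unique smooth structure on `X/conj` such that the projection
`X → X/conj` is a double covering branched over `ℝX`"; Finashin 1997, §1.1: "If `X` is
nonsingular, then `Y` is a closed `4`-manifold, which inherits an orientation and smooth
structure from `X`, so that the quotient map, `q : X → Y`, is an orientation preserving and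
smooth double covering branched along the fixed points set, `X_ℝ`, of the conjugation."
Existence half only (uniqueness and orientations not vendored). Grounds
`Summit.SmoothPoincare4.SmoothPoincare4.Theses.RealQuotientSpheres.RqQuotientExists`
(= this fact restricted to `σ` with a fixed point, predicates unfolded coordinatewise).
[cite: DegtyarevKharlamov2000, §3.2 (arXiv:math/0004134 p. 14); Finashin1997, §1.1 ¶1
(arXiv:dg-ga/9603004 p. 1)] -/
def conjQuotient_smoothStructure_exists : Prop :=
  ∀ (X : Type) [TopologicalSpace X] [T2Space X] [SecondCountableTopology X] [CompactSpace X]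
    [ChartedSpace (Fin 2 → ℂ) X] [IsManifold 𝓘(ℂ, Fin 2 → ℂ) ω X] (σ : X → X),
    Literature.Geometry.Kaehler.IsRealStructure 𝓘(ℂ, Fin 2 → ℂ) σ →
    ∃ (Y : Type) (_ : TopologicalSpace Y) (_ : T2Space Y) (_ : SecondCountableTopology Y)
      (_ : CompactSpace Y) (_ : ChartedSpace (EuclideanSpace ℝ (Fin 4)) Y)
      (_ : IsManifold (𝓡 4) ∞ Y) (q : X → Y), IsBranchedDoubleQuotient σ q

end Literature.Topology.FourManifolds

end
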